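import Literature.AlgebraicGeometry.RealAlgebraic.DividingCurves
import Literature.NumberTheory.Transcendental.AnalytificationImplicit
import HarnessLib

/-!
# Local holomorphic charts of a nonsingular complex plane curve, and their real structure

Topic `Literature/AlgebraicGeometry/RealAlgebraic`; sequel to `DividingCurves.lean` (vocabulary
`complexZeroLocus`, `nonRealLocus`, `half`, `posTangent`, `imPairing`). For a polynomial `p` in
two variables with coefficients mapped into `ℂ`, at a point `z₀` of the affine curve
`A = {p = 0} ⊆ ℂ²` with `∂p/∂x_l (z₀) ≠ 0`, the holomorphic implicit function theorem (the tree's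
`Literature.NumberTheory.Transcendental.exists_implicitChart`, Serre GAGA §2 / Gunning–Rossi I.B.9)
makes `A` near `z₀` the graph `x_l = g(x_k)` of a holomorphic function of the other coordinate
`x_k`: an open `Ω ∋ z₀` and a disc `D` around `z₀ k` with `A ∩ Ω ∩ {x_k ∈ D}` parametrised
bijectively by `ψ(t) = (t, g(t))`, `t ∈ D` (`exists_localChart`). **Everything here is proved; no
definition and no named fact is introduced.** Consequences:

* `exists_isOpen_inter_subset_half` — every NON-REAL point of `A` has a neighbourhood in which
  `A` lies in one half (connected component of the non-real locus): `A` is locally connected and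
  the non-real locus is open in it;
* `exists_realChart` — at a REAL point `v` (coefficients mapped through `ℝ`): the chart is REAL,
  `ψ(conj t) = conj ψ(t)` (uniqueness of the implicit function), so the non-real points of `A`
  near `v` are `ψ(D ∖ ℝ) = ψ(D⁺) ∪ ψ(D⁻)`, two connected pieces interchanged by `conj`; and for
  every real `s ∈ D`, near the real point `ψ(s)` the sign of the pairing
  `⟪Im w, J∇p(ψ(s))⟫` (`imPairing (posTangent …)`, the side datum of `halfSideSign` in
  `DividingCurves.lean`) on `w = ψ(t)` is the sign of `κ · Im t` for ONE non-zero real constant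
  `κ` of the chart (first-order expansion `Im g(s + iu) = u g'(s) + o(u)` from strict
  differentiability, `g'(s) = -∂ₖp/∂ₗp` real, `⟪(1, g'(s)), J∇p⟫ = ∓|∇p|²/∂ₗp ≠ 0`).

These are the local inputs of Rokhlin's two-halves theorem (`TwoHalves.lean`) and of the
well-definedness of complex orientations (`complexOrientationSign_isUnit_of_isDividing`,
`ComplexOrientationFormula.lean`; Rokhlin 1974 §2: "near a real point the non-real points form two
half-neighbourhoods interchanged by `conj`").

## References

* [Rokhlin1974] V. A. Rokhlin, Complex orientations of real algebraic curves, Funct. Anal. Appl.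
  8 (1974) 331–334, §2.
* [DegtyarevKharlamov2000] A. Degtyarev, V. Kharlamov, Topological properties of real algebraic
  varieties: du côté de chez Rokhlin, Russian Math. Surveys 55 (2000), §1.
* R. C. Gunning, H. Rossi, Analytic functions of several complex variables (1965), Ch. I §B Thm. 9.
-/

noncomputable section

open MvPolynomial Set Filter Metric
open scoped _root_.Topology _root_.ComplexConjugate

namespace Literature.AlgebraicGeometry.RealAlgebraic

/-! ### Two indices -/

section Indices

/-- A sum over `Fin 2` is the sum of the values at two distinct indices. [folklore] -/
theorem sum_eq_add_of_ne {M : Type*} [AddCommMonoid M] {k l : Fin 2} (hkl : k ≠ l) (f : Fin 2 → M) :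
    ∑ j, f j = f k + f l := by
  fin_cases k <;> fin_cases l
  · exact absurd rfl hkl
  · simp [Fin.sum_univ_two]
  · simp [Fin.sum_univ_two, add_comm]
  · exact absurd rfl hkl

/-- Two functions on `Fin 2` agreeing at two distinct indices are equal. [folklore] -/
theorem funext_of_ne {X : Type*} {k l : Fin 2} (hkl : k ≠ l) {z z' : Fin 2 → X} (hk : z k = z' k)
    (hl : z l = z' l) : z = z' := by
  funext j
  fin_cases k <;> fin_cases l
  · exact absurd rfl hkl
  · fin_cases j <;> assumption
  · fin_cases j <;> assumption
  · exact absurd rfl hkl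

/-- Every index of `Fin 2` is one of two distinct ones. [folklore] -/
theorem eq_or_eq_of_ne {k l : Fin 2} (hkl : k ≠ l) (j : Fin 2) : j = k ∨ j = l := by
  fin_cases k <;> fin_cases l
  · exact absurd rfl hkl
  · fin_cases j <;> simp
  · fin_cases j <;> simp
  · exact absurd rfl hkl

/-- The transposition `(0 k)` of `Fin 2` sends `1` to the index other than `k`. [folklore] -/
theorem swap_zero_apply_one {k l : Fin 2} (hkl : k ≠ l) : Equiv.swap (0 : Fin 2) k 1 = l := by
  fin_cases k <;> fin_cases l
  · exact absurd rfl hkl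
  · rfl
  · rfl
  · exact absurd rfl hkl

/-- The components of the positive tangent `J ∇p(v)` at the two indices: `τ_k = -ε ∂ₗp`,
`τ_l = ε ∂ₖp` with `ε = +1` if `k = 0` and `ε = -1` if `k = 1`. [folklore] -/
theorem posTangent_apply_of_ne {R : Type*} [CommSemiring R] [Algebra R ℂ] (p : MvPolynomial (Fin 2) R)
    (v : Fin 2 → ℝ) {k l : Fin 2} (hkl : k ≠ l) :
    posTangent p v k = -(if k = 0 then 1 else -1) * realGrad p v l ∧
      posTangent p v l = (if k = 0 then 1 else -1) * realGrad p v k := by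
  fin_cases k <;> fin_cases l
  · exact absurd rfl hkl
  · simp [posTangent]
  · simp [posTangent]
  · exact absurd rfl hkl

end Indices

variable {R : Type*} [CommSemiring R] [Algebra R ℂ]

/-! ### The local chart -/

section Chart

variable (p : MvPolynomial (Fin 2) R)

/-- Evaluating in `ℂ` is evaluating the complex polynomial `map (algebraMap R ℂ) p`. [folklore] -/
theorem aeval_eq_eval_mapC (w : Fin 2 → ℂ) : aeval w p = eval w (map (algebraMap R ℂ) p) := by
  rw [eval_map, aeval_def]

/-- **Local holomorphic chart of a nonsingular plane curve.** Let `z₀ ∈ A = {p = 0} ⊆ ℂ²` with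
`∂p/∂x_l (z₀) ≠ 0`, and let `k ≠ l` be the other index. There are an open `Ω ∋ z₀`, a radius
`r > 0` and a map `ψ : ℂ → ℂ²`, analytic on the disc `D = B(z₀ k, r)`, such that `ψ(D) ⊆ A ∩ Ω`,
`ψ(t)_k = t`, and every point `z ∈ A ∩ Ω` is `ψ(z_k)` (so `A ∩ Ω ∩ {z_k ∈ D} = ψ(D)`,
bijectively). From the tree's holomorphic implicit function theorem for polynomial equations
(`Literature.NumberTheory.Transcendental.exists_implicitChart`). [folklore] -/
theorem exists_localChart {z₀ : Fin 2 → ℂ} (hz₀ : aeval z₀ p = 0) {k l : Fin 2} (hkl : k ≠ l)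
    (hl : aeval z₀ (pderiv l p) ≠ 0) :
    ∃ (Ω : Set (Fin 2 → ℂ)) (r : ℝ) (ψ : ℂ → Fin 2 → ℂ), IsOpen Ω ∧ z₀ ∈ Ω ∧ 0 < r ∧
      (∀ t ∈ ball (z₀ k) r, AnalyticAt ℂ ψ t) ∧
      (∀ t ∈ ball (z₀ k) r, ψ t ∈ Ω ∧ aeval (ψ t) p = 0 ∧ ψ t k = t) ∧
      (∀ z ∈ Ω, aeval z p = 0 → ψ (z k) = z) := by
  classical
  set pC : MvPolynomial (Fin 2) ℂ := map (algebraMap R ℂ) p with hpC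
  -- coordinates: free `k` first, dependent `l` second
  set E : Fin 1 ⊕ Fin 1 ≃ Fin 2 := finSumFinEquiv.trans (Equiv.swap (0 : Fin 2) k) with hE
  have hEk : ∀ t : Fin 1, E (Sum.inl t) = k := by
    intro t
    rw [Subsingleton.elim t 0]
    simp only [hE, Equiv.trans_apply, finSumFinEquiv_apply_left]
    exact Equiv.swap_apply_left _ _
  have hEl : ∀ t : Fin 1, E (Sum.inr t) = l := by
    intro t
    rw [Subsingleton.elim t 0]
    simp only [hE, Equiv.trans_apply, finSumFinEquiv_apply_right]
    exact swap_zero_apply_one hkl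
  have hJ : (Matrix.of fun i j : Fin 1 => eval z₀ (pderiv (E (Sum.inr i)) ((fun _ : Fin 1 => pC) j))).det
      ≠ 0 := by
    rw [Matrix.det_fin_one]
    simp only [Matrix.of_apply, hEl]
    rwa [hpC, pderiv_map, ← aeval_eq_eval_mapC]
  obtain ⟨Ω, T, ψ₁, hΩ, hz₀Ω, hT, hψ₁, h1, h2⟩ :=
    Literature.NumberTheory.Transcendental.exists_implicitChart E (fun _ : Fin 1 => pC) z₀ hJ
  -- one complex variable instead of `Fin 1 → ℂ`
  set emb : ℂ → (Fin 1 → ℂ) := fun t _ => t with hemb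
  have hembc : Continuous emb := continuous_pi fun _ => continuous_id
  have hemba : ∀ t, AnalyticAt ℂ emb t := fun t => analyticAt_pi_iff.2 fun _ => analyticAt_id
  have hproj : ∀ z : Fin 2 → ℂ, (fun t : Fin 1 => z (E (Sum.inl t))) = emb (z k) := by
    intro z; funext t; simp [hemb, hEk]
  have hz₀T : emb (z₀ k) ∈ T := by
    have := (h1 z₀ hz₀Ω (fun _ => by rw [hpC, ← aeval_eq_eval_mapC]; exact hz₀)).1
    rwa [hproj] at this
  obtain ⟨r, hr, hball⟩ := Metric.isOpen_iff.1 (hT.preimage hembc) (z₀ k) hz₀T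
  refine ⟨Ω, r, fun t => ψ₁ (emb t), hΩ, hz₀Ω, hr, fun t ht => (hψ₁ _ (hball ht)).comp (hemba t),
    fun t ht => ?_, fun z hz hz0 => ?_⟩
  · obtain ⟨hΩ', hF, hπ⟩ := h2 (emb t) (hball ht)
    refine ⟨hΩ', ?_, ?_⟩
    · rw [aeval_eq_eval_mapC]; exact hF 0
    · have := congr_fun hπ 0
      simpa [hemb, hEk] using this
  · have := (h1 z hz (fun _ => by rw [hpC, ← aeval_eq_eval_mapC]; exact hz0)).2
    rwa [hproj] at this

/-- **Near a non-real point the curve stays in one half.** If `A` is nonsingular, every point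
`z₀` of the non-real locus has an open neighbourhood `N` with `A ∩ N ⊆ half p z₀` (the connected
component of `z₀` in the non-real locus): a small chart disc has connected image inside the
(open) non-real locus. [folklore] -/
theorem exists_isOpen_inter_subset_half
    (hsm : ∀ w ∈ complexZeroLocus p, ∃ i, aeval w (pderiv i p) ≠ 0) {z₀ : Fin 2 → ℂ}
    (hz₀ : z₀ ∈ nonRealLocus p) :
    ∃ N : Set (Fin 2 → ℂ), IsOpen N ∧ z₀ ∈ N ∧ complexZeroLocus p ∩ N ⊆ half p z₀ := by
  obtain ⟨hz₀A, m, hm⟩ := hz₀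
  obtain ⟨l, hl⟩ := hsm z₀ hz₀A
  obtain ⟨k, hkl⟩ : ∃ k : Fin 2, k ≠ l := ⟨l + 1, by fin_cases l <;> decide⟩
  obtain ⟨Ω, r, ψ, hΩ, hz₀Ω, hr, hψa, hψ, huniq⟩ := exists_localChart p hz₀A hkl hl
  have hψz₀ : ψ (z₀ k) = z₀ := huniq z₀ hz₀Ω hz₀A
  -- shrink the disc so that the coordinate `m` stays non-real
  have hg : Continuous fun z : Fin 2 → ℂ => (z m).im :=
    Complex.continuous_im.comp (continuous_apply m)
  have hcont : ContinuousAt (fun t => ((ψ t) m).im) (z₀ k) :=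
    hg.continuousAt.comp (hψa _ (mem_ball_self hr)).continuousAt
  have hne : ∀ᶠ t in 𝓝 (z₀ k), ((ψ t) m).im ≠ 0 :=
    hcont.eventually_ne (by rw [hψz₀]; exact hm)
  obtain ⟨r₁, hr₁, hball₁⟩ := Metric.eventually_nhds_iff.1 (hne.and (eventually_mem_set.2
    (isOpen_ball.mem_nhds (mem_ball_self hr))))
  refine ⟨Ω ∩ (fun z : Fin 2 → ℂ => z k) ⁻¹' ball (z₀ k) r₁,
    hΩ.inter (isOpen_ball.preimage (continuous_apply k)), ⟨hz₀Ω, mem_ball_self hr₁⟩, ?_⟩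
  -- the image of the small disc is a connected subset of the non-real locus containing `z₀`
  have hsub : ψ '' ball (z₀ k) r₁ ⊆ nonRealLocus p := by
    rintro _ ⟨t, ht, rfl⟩
    obtain ⟨hne', ht'⟩ := hball₁ ht
    exact ⟨(hψ t ht').2.1, m, hne'⟩
  have hpre : IsPreconnected (ψ '' ball (z₀ k) r₁) :=
    (isConnected_ball (x := z₀ k) hr₁).isPreconnected.image _ fun t ht =>
      (hψa t (hball₁ ht).2).continuousAt.continuousWithinAt
  have hz₀im : z₀ ∈ ψ '' ball (z₀ k) r₁ := ⟨z₀ k, mem_ball_self hr₁, hψz₀⟩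
  rintro z ⟨hzA, hzΩ, hzk⟩
  exact subset_half_of_isPreconnected hpre hsub hz₀im ⟨z k, hzk, huniq z hzΩ hzA⟩

end Chart

/-! ### Lemmas of one real and one complex variable -/

section OneVariable

/-- The norm of a real multiple of `I`. [folklore] -/
theorem norm_ofReal_mul_I (x : ℝ) : ‖(x : ℂ) * Complex.I‖ = |x| := by
  rw [norm_mul, Complex.norm_I, mul_one, Complex.norm_real, Real.norm_eq_abs]

/-- Two real numbers of the same sign give products of the same sign. [folklore] -/
theorem mul_pos_iff_and_mul_neg_iff_of_mul_pos {a b : ℝ} (hab : 0 < a * b) (x : ℝ) :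
    (0 < a * x ↔ 0 < b * x) ∧ (a * x < 0 ↔ b * x < 0) := by
  have ha : a ≠ 0 := by rintro rfl; simp at hab
  have haa : 0 < a * a := mul_self_pos.2 ha
  have e : ∀ y : ℝ, a * y * (a * b) = a * a * (b * y) := fun y => by ring
  have key : ∀ y : ℝ, 0 < a * y ↔ 0 < b * y := fun y => by
    rw [← mul_pos_iff_of_pos_right hab, e, mul_pos_iff_of_pos_left haa]
  refine ⟨key x, ?_⟩
  rw [← neg_pos, ← neg_pos (a := b * x), ← mul_neg, ← mul_neg]
  exact key (-x)

/-- **First-order expansion of the imaginary part of a real holomorphic function off the real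
axis.** If `g` is strictly differentiable at the real point `s` with real derivative `d`, and
`g(conj t) = conj g(t)` near `s`, then `|Im g(t) - Im t · d| ≤ η |Im t|` near `s`, for every
`η > 0`: compare `t` with `conj t` in the strict differentiability estimate. [folklore] -/
theorem eventually_abs_im_sub_le {g : ℂ → ℂ} {d : ℂ} {s : ℝ} (hg : HasStrictDerivAt g d s)
    (hd : d.im = 0) (hreal : ∀ᶠ t in 𝓝 (s : ℂ), g (conj t) = conj (g t)) {η : ℝ} (hη : 0 < η) :
    ∀ᶠ t in 𝓝 (s : ℂ), |(g t).im - t.im * d.re| ≤ η * |t.im| := by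
  have ho := (hasDerivAtFilter_iff_isLittleO.1 hg).def hη
  -- evaluate the estimate at the pairs `(t, conj t) → (s, s)`
  have hpair : Tendsto (fun t : ℂ => (t, conj t)) (𝓝 (s : ℂ)) (𝓝 ((s : ℂ), (s : ℂ))) := by
    have h : Continuous fun t : ℂ => (t, conj t) := continuous_id.prodMk Complex.continuous_conj
    simpa [Complex.conj_ofReal] using h.tendsto (s : ℂ)
  filter_upwards [hpair.eventually ho, hreal] with t ht hrt
  rw [hrt] at ht
  have key : g t - conj (g t) - (t - conj t) • d =
      ((2 * ((g t).im - t.im * d.re) : ℝ) : ℂ) * Complex.I := by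
    apply Complex.ext
    · simp [Complex.mul_re, hd]
    · simp [Complex.mul_im, hd]
      ring
  rw [key, Complex.sub_conj, norm_ofReal_mul_I, norm_ofReal_mul_I, abs_mul, abs_mul,
    abs_of_pos (by norm_num : (0 : ℝ) < 2)] at ht
  nlinarith [ht, abs_nonneg ((g t).im - t.im * d.re), abs_nonneg t.im]

end OneVariable

/-! ### The real structure of the chart at a real point -/

section RealChart

variable [Algebra R ℝ] [IsScalarTower R ℝ ℂ]
variable (p : MvPolynomial (Fin 2) R)

omit [Algebra R ℝ] [IsScalarTower R ℝ ℂ] [Algebra R ℂ] [CommSemiring R] in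
/-- The pairing `⟪Im w, τ⟫` written with two distinct indices. [folklore] -/
theorem imPairing_eq_of_ne {k l : Fin 2} (hkl : k ≠ l) (τ : Fin 2 → ℝ) (w : Fin 2 → ℂ) :
    imPairing τ w = (w k).im * τ k + (w l).im * τ l := by
  fin_cases k <;> fin_cases l
  · exact absurd rfl hkl
  · rfl
  · simp only [imPairing, Fin.zero_eta, Fin.mk_one]
    ring
  · exact absurd rfl hkl

omit [Algebra R ℝ] [IsScalarTower R ℝ ℂ] in
/-- **Implicit differentiation along the chart**: `∂ₖp(ψ(s)) + ∂ₗp(ψ(s)) g'(s) = 0` for the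
dependent coordinate `g = ψ(·)_l`, at any point `s` near which `ψ` is analytic, `ψ(t)_k = t` and
`p(ψ(t)) = 0`. [folklore] -/
theorem chart_deriv_identity {ψ : ℂ → Fin 2 → ℂ} {k l : Fin 2} (hkl : k ≠ l) {s : ℂ}
    (hψa : AnalyticAt ℂ ψ s) (hk : ∀ᶠ t in 𝓝 s, ψ t k = t) (h0 : ∀ᶠ t in 𝓝 s, aeval (ψ t) p = 0) :
    aeval (ψ s) (pderiv k p) + aeval (ψ s) (pderiv l p) * deriv (fun t => ψ t l) s = 0 := by
  set pC : MvPolynomial (Fin 2) ℂ := map (algebraMap R ℂ) p with hpC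
  have hψd : HasDerivAt ψ (deriv ψ s) s := hψa.differentiableAt.hasDerivAt
  have hk1 : deriv ψ s k = 1 :=
    (hasDerivAt_pi.1 hψd k).unique ((hasDerivAt_id s).congr_of_eventuallyEq hk)
  have hl' : deriv (fun t => ψ t l) s = deriv ψ s l := (hasDerivAt_pi.1 hψd l).deriv
  -- the composite `t ↦ p(ψ(t))` vanishes identically near `s`
  have hcomp := (Literature.NumberTheory.Transcendental.hasFDerivAt_eval pC (ψ s)).comp_hasDerivAt
    s hψd
  have hzero : HasDerivAt (fun t => eval (ψ t) pC) 0 s := by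
    refine (hasDerivAt_const s (0 : ℂ)).congr_of_eventuallyEq ?_
    filter_upwards [h0] with t ht
    rw [hpC, ← aeval_eq_eval_mapC, ht]
  have huniq := hcomp.unique hzero
  simp only [_root_.sum_apply, _root_.smul_apply, ContinuousLinearMap.proj_apply, smul_eq_mul]
    at huniq
  rw [sum_eq_add_of_ne hkl, hk1, mul_one, hpC, pderiv_map, pderiv_map, ← aeval_eq_eval_mapC,
    ← aeval_eq_eval_mapC] at huniq
  rw [hl']
  exact huniq

/-- **Real local chart at a real point** (existence and reality). At a real zero `v` of `p`
(coefficients mapped through `ℝ`) with `∂ₗp(v) ≠ 0`, `k ≠ l`: a local chart `ψ` on a disc `D`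
around `v k ∈ ℝ ⊆ ℂ` as in `exists_localChart`, which moreover is REAL — `ψ(conj t) = conj ψ(t)`
on `D` (uniqueness of the implicit function applied to `conj ψ(t) ∈ A`) — and on which
`Re ∂ₗp(ψ(t))` keeps the sign of `∂ₗp(v)`. [folklore] -/
theorem exists_realChart_aux (v : Fin 2 → ℝ) (hv : aeval v p = 0) {k l : Fin 2} (hkl : k ≠ l)
    (hl : aeval v (pderiv l p) ≠ 0) :
    ∃ (Ω : Set (Fin 2 → ℂ)) (r : ℝ) (ψ : ℂ → Fin 2 → ℂ), IsOpen Ω ∧ (fun j => (v j : ℂ)) ∈ Ω ∧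
      0 < r ∧ (∀ t ∈ ball ((v k : ℂ)) r, AnalyticAt ℂ ψ t) ∧
      (∀ t ∈ ball ((v k : ℂ)) r, ψ t ∈ Ω ∧ aeval (ψ t) p = 0 ∧ ψ t k = t ∧
        ψ (conj t) = star (ψ t) ∧ 0 < aeval v (pderiv l p) * (aeval (ψ t) (pderiv l p)).re) ∧
      (∀ z ∈ Ω, aeval z p = 0 → ψ (z k) = z) := by
  set z₀ : Fin 2 → ℂ := fun j => (v j : ℂ) with hz₀
  have hz₀A : aeval z₀ p = 0 := by rw [hz₀, aeval_ofReal, hv, Complex.ofReal_zero]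
  have hl' : aeval z₀ (pderiv l p) ≠ 0 := by
    rw [hz₀, aeval_ofReal, Complex.ofReal_ne_zero]; exact hl
  obtain ⟨Ω, r₀, ψ, hΩ, hz₀Ω, hr₀, hψa, hψ, huniq⟩ := exists_localChart p hz₀A hkl hl'
  have hz₀k : z₀ k = (v k : ℂ) := rfl
  rw [hz₀k] at hψa hψ
  have hψz₀ : ψ (v k : ℂ) = z₀ := huniq z₀ hz₀Ω hz₀A
  have hcont : ContinuousAt ψ (v k : ℂ) := (hψa _ (mem_ball_self hr₀)).continuousAt
  -- (i) `conj ψ(t) ∈ Ω` near `v k`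
  have h1 : ∀ᶠ t in 𝓝 (v k : ℂ), star (ψ t) ∈ Ω := by
    have : star ⁻¹' Ω ∈ 𝓝 (ψ (v k : ℂ)) := by
      refine (hΩ.preimage continuous_star).mem_nhds ?_
      rw [hψz₀, mem_preimage, hz₀, star_ofReal_comp]
      exact hz₀Ω
    exact hcont.preimage_mem_nhds this
  -- (ii) `Re ∂ₗp(ψ t)` keeps the sign of `∂ₗp(v)`
  have h2 : ∀ᶠ t in 𝓝 (v k : ℂ), 0 < aeval v (pderiv l p) * (aeval (ψ t) (pderiv l p)).re := by
    have hg : Continuous fun z : Fin 2 → ℂ => (aeval z (pderiv l p)).re := by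
      simp_rw [aeval_eq_eval_mapC]
      exact Complex.continuous_re.comp (MvPolynomial.continuous_eval _)
    have hc : ContinuousAt (fun t => aeval v (pderiv l p) * (aeval (ψ t) (pderiv l p)).re)
        (v k : ℂ) := continuousAt_const.mul (hg.continuousAt.comp hcont)
    refine hc.eventually (isOpen_Ioi.mem_nhds ?_)
    show 0 < aeval v (pderiv l p) * (aeval (ψ (v k : ℂ)) (pderiv l p)).re
    rw [hψz₀, hz₀, aeval_ofReal, Complex.ofReal_re]
    exact mul_self_pos.2 hl
  obtain ⟨r, hr, hballr⟩ := Metric.eventually_nhds_iff.1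
    ((h1.and h2).and (eventually_mem_set.2 (isOpen_ball.mem_nhds (mem_ball_self hr₀))))
  have hmem : ∀ t ∈ ball (v k : ℂ) r, star (ψ t) ∈ Ω ∧
      0 < aeval v (pderiv l p) * (aeval (ψ t) (pderiv l p)).re ∧ t ∈ ball (v k : ℂ) r₀ :=
    fun t ht => ⟨(hballr ht).1.1, (hballr ht).1.2, (hballr ht).2⟩
  refine ⟨Ω, r, ψ, hΩ, hz₀Ω, hr, fun t ht => hψa t (hmem t ht).2.2, fun t ht => ?_, huniq⟩
  obtain ⟨hstar, hsign, ht₀⟩ := hmem t ht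
  obtain ⟨hΩt, hAt, hkt⟩ := hψ t ht₀
  refine ⟨hΩt, hAt, hkt, ?_, hsign⟩
  -- reality, by uniqueness of the implicit function
  have hA' : aeval (star (ψ t)) p = 0 := by rw [aeval_star, hAt, map_zero]
  have := huniq (star (ψ t)) hstar hA'
  rwa [star_apply, hkt] at this

/-- **The side of the chart at real points.** In a real chart `ψ` (as in
`exists_realChart_aux`) at the real zero `v`, for every real `s` in the disc the point `ψ(s)` is
real, and near it the sign of the pairing `⟪Im ψ(t), J∇p(ψ(s))⟫` is the sign of `κ · Im t` with
the chart constant `κ = ∓ ∂ₗp(v)` (`-` for `k = 0`, `+` for `k = 1`): by implicit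
differentiation `g'(s) = -∂ₖp/∂ₗp` is real, `⟪(Im t, Im g(t)), J∇p⟫ = Im t · c + o(Im t)` with
`c = ∓ |∇p|²/∂ₗp (ψ(s)) ≠ 0` of the sign of `κ`. [cite: Rokhlin1974, §2] -/
theorem chart_sign {ψ : ℂ → Fin 2 → ℂ} {k l : Fin 2} (hkl : k ≠ l) {v : Fin 2 → ℝ} {r : ℝ}
    (hψa : ∀ t ∈ ball ((v k : ℂ)) r, AnalyticAt ℂ ψ t)
    (hψ : ∀ t ∈ ball ((v k : ℂ)) r, aeval (ψ t) p = 0 ∧ ψ t k = t ∧ ψ (conj t) = star (ψ t) ∧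
      0 < aeval v (pderiv l p) * (aeval (ψ t) (pderiv l p)).re)
    {s : ℝ} (hs : (s : ℂ) ∈ ball ((v k : ℂ)) r) :
    ∃ ρ > 0, ball (s : ℂ) ρ ⊆ ball ((v k : ℂ)) r ∧ ∀ t ∈ ball (s : ℂ) ρ,
      (0 < imPairing (posTangent p (fun j => (ψ s j).re)) (ψ t) ↔
          0 < -(if k = 0 then 1 else -1 : ℝ) * aeval v (pderiv l p) * t.im) ∧
      (imPairing (posTangent p (fun j => (ψ s j).re)) (ψ t) < 0 ↔
          -(if k = 0 then 1 else -1 : ℝ) * aeval v (pderiv l p) * t.im < 0) := by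
  -- the real point `ψ s`
  obtain ⟨hA₁, hk₁, hreal₁, hsign₁⟩ := hψ _ hs
  rw [Complex.conj_ofReal] at hreal₁
  have him : ∀ j, (ψ s j).im = 0 := fun j => Complex.conj_eq_iff_im.1 (by
    have h := congr_fun hreal₁ j
    rw [star_apply] at h
    exact h.symm)
  set v₁ : Fin 2 → ℝ := fun j => (ψ s j).re with hv₁
  have hv₁z : (fun j => (v₁ j : ℂ)) = ψ s :=
    funext fun j => Complex.ext (by simp [hv₁]) (by simp [him j])
  obtain ⟨hτk, hτl⟩ := posTangent_apply_of_ne p v₁ hkl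
  set G : Fin 2 → ℝ := realGrad p v₁ with hG
  set τ : Fin 2 → ℝ := posTangent p v₁ with hτ
  set ε : ℝ := (if k = 0 then 1 else -1 : ℝ) with hε
  set Gv : ℝ := aeval v (pderiv l p) with hGv
  have hε2 : ε * ε = 1 := by rw [hε]; split_ifs <;> norm_num
  have hε0 : ε ≠ 0 := fun h => by rw [h, mul_zero] at hε2; exact zero_ne_one hε2
  -- real gradient at `ψ s`
  have hGc : ∀ j, aeval (ψ s) (pderiv j p) = (G j : ℂ) := by
    intro j
    rw [hG, realGrad_apply, ← aeval_ofReal, hv₁z]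
  have hGl : 0 < Gv * G l := by
    have h := hsign₁
    rwa [hGc l, Complex.ofReal_re] at h
  have hGl0 : G l ≠ 0 := fun h => by rw [h, mul_zero] at hGl; exact lt_irrefl _ hGl
  have hGv0 : Gv ≠ 0 := fun h => by rw [h, zero_mul] at hGl; exact lt_irrefl _ hGl
  -- implicit differentiation: the derivative of the dependent coordinate is `-G k / G l`
  have hball : ball ((v k : ℂ)) r ∈ 𝓝 (s : ℂ) := isOpen_ball.mem_nhds hs
  have hident : (G k : ℂ) + (G l : ℂ) * deriv (fun t => ψ t l) s = 0 := by
    have h := chart_deriv_identity p hkl (hψa _ hs)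
      (Filter.mem_of_superset hball fun t ht => (hψ t ht).2.1)
      (Filter.mem_of_superset hball fun t ht => (hψ t ht).1)
    rwa [hGc k, hGc l] at h
  set g : ℂ → ℂ := fun t => ψ t l with hg
  set d : ℂ := deriv g s with hd
  have hdval : d = ((-(G k) / G l : ℝ) : ℂ) := by
    have hGlc : (G l : ℂ) ≠ 0 := Complex.ofReal_ne_zero.2 hGl0
    push_cast
    rw [eq_div_iff hGlc]
    linear_combination hident
  have hdim : d.im = 0 := by rw [hdval, Complex.ofReal_im]
  have hdre : d.re = -(G k) / G l := by rw [hdval, Complex.ofReal_re]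
  -- the leading coefficient `c` and the chart constant `κ`
  set c : ℝ := τ k + d.re * τ l with hc
  set κ : ℝ := -ε * Gv with hκ
  have hcκ : 0 < c * κ := by
    have hGl2 : 0 < G l * G l := mul_self_pos.2 hGl0
    have key : c * κ * (G l * G l) = ε * ε * ((G l * G l + G k * G k) * (Gv * G l)) := by
      rw [hc, hκ, hτk, hτl, hdre]
      field_simp
      ring
    rw [hε2, one_mul] at key
    have hpos : 0 < (G l * G l + G k * G k) * (Gv * G l) :=
      mul_pos (add_pos_of_pos_of_nonneg hGl2 (mul_self_nonneg _)) hGl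
    rw [← key] at hpos
    exact pos_of_mul_pos_left hpos hGl2.le
  have hc0 : c ≠ 0 := fun h => by rw [h, zero_mul] at hcκ; exact lt_irrefl _ hcκ
  -- the first-order estimate for `Im g`
  set η : ℝ := |c| / (2 * (|τ l| + 1)) with hη
  have hη0 : 0 < η := by
    rw [hη]
    have := abs_pos.2 hc0
    positivity
  have hηc : η * |τ l| ≤ |c| / 2 := by
    rw [hη, div_mul_eq_mul_div, div_le_div_iff₀ (by positivity) (by norm_num)]
    nlinarith [abs_nonneg c, abs_nonneg (τ l)]
  have hgs : HasStrictDerivAt g d s :=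
    ((ContinuousLinearMap.proj l : (Fin 2 → ℂ) →L[ℂ] ℂ).analyticAt _ |>.comp (hψa _ hs)).hasStrictDerivAt
  have hgreal : ∀ᶠ t in 𝓝 (s : ℂ), g (conj t) = conj (g t) := by
    filter_upwards [hball] with t ht
    simp only [hg]
    rw [(hψ t ht).2.2.1, star_apply]
  obtain ⟨ρ₀, hρ₀, hballρ₀⟩ :=
    Metric.eventually_nhds_iff.1 (eventually_abs_im_sub_le hgs hdim hgreal hη0)
  -- the radius
  have hsr : dist (s : ℂ) (v k : ℂ) < r := mem_ball.1 hs
  set ρ : ℝ := min ρ₀ (r - dist (s : ℂ) (v k : ℂ)) with hρ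
  have hρ0 : 0 < ρ := lt_min hρ₀ (sub_pos.2 hsr)
  have hρle : ρ ≤ r - dist (s : ℂ) (v k : ℂ) := min_le_right _ _
  have hsub : ball (s : ℂ) ρ ⊆ ball ((v k : ℂ)) r := fun t ht => by
    rw [mem_ball] at ht ⊢
    calc dist t (v k : ℂ) ≤ dist t (s : ℂ) + dist (s : ℂ) (v k : ℂ) := dist_triangle _ _ _
      _ < ρ + dist (s : ℂ) (v k : ℂ) := by gcongr
      _ ≤ (r - dist (s : ℂ) (v k : ℂ)) + dist (s : ℂ) (v k : ℂ) := by gcongr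
      _ = r := by ring
  refine ⟨ρ, hρ0, hsub, fun t ht => ?_⟩
  have htr := hsub ht
  have hest : |(g t).im - t.im * d.re| ≤ η * |t.im| :=
    hballρ₀ (lt_of_lt_of_le (mem_ball.1 ht) (min_le_left _ _))
  -- the pairing, decomposed into the leading term and the error
  have hpair : imPairing τ (ψ t) = t.im * c + ((g t).im - t.im * d.re) * τ l := by
    rw [imPairing_eq_of_ne hkl, (hψ t htr).2.1, hc]
    simp only [hg]
    ring
  have herr : |((g t).im - t.im * d.re) * τ l| ≤ |c| / 2 * |t.im| := by
    rw [abs_mul]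
    calc |(g t).im - t.im * d.re| * |τ l| ≤ η * |t.im| * |τ l| :=
          mul_le_mul_of_nonneg_right hest (abs_nonneg _)
      _ = η * |τ l| * |t.im| := by ring
      _ ≤ |c| / 2 * |t.im| := mul_le_mul_of_nonneg_right hηc (abs_nonneg _)
  -- the sign of the pairing is the sign of `c · Im t` ...
  have hsignc : (0 < imPairing τ (ψ t) ↔ 0 < c * t.im) ∧ (imPairing τ (ψ t) < 0 ↔ c * t.im < 0) := by
    rw [hpair]
    have habs := abs_le.1 herr
    have h1 : |c| / 2 * |t.im| = |c * t.im| / 2 := by rw [abs_mul]; ring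
    rw [h1] at habs
    rcases lt_trichotomy (c * t.im) 0 with hneg | hzero | hpos
    · rw [abs_of_neg hneg] at habs
      refine ⟨iff_of_false (fun h => ?_) (not_lt.2 hneg.le), iff_of_true ?_ hneg⟩
      · linarith only [habs.2, h, hneg]
      · linarith only [habs.2, hneg]
    · have htim : t.im = 0 := (mul_eq_zero.1 hzero).resolve_left hc0
      have herr0 : ((g t).im - t.im * d.re) * τ l = 0 := by
        have h : |((g t).im - t.im * d.re) * τ l| ≤ 0 := by simpa [htim] using herr
        exact abs_nonpos_iff.1 h
      rw [herr0, hzero, htim]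
      simp
    · rw [abs_of_pos hpos] at habs
      refine ⟨iff_of_true ?_ hpos, iff_of_false (fun h => ?_) (not_lt.2 hpos.le)⟩
      · linarith only [habs.1, hpos]
      · linarith only [habs.1, h, hpos]
  -- ... which is the sign of `κ · Im t`
  have hκc := mul_pos_iff_and_mul_neg_iff_of_mul_pos hcκ t.im
  show (0 < imPairing τ (ψ t) ↔ 0 < κ * t.im) ∧ (imPairing τ (ψ t) < 0 ↔ κ * t.im < 0)
  exact ⟨hsignc.1.trans hκc.1, hsignc.2.trans hκc.2⟩

end RealChart

/-! ### The two half-discs of a real chart -/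

section HalfDiscs

/-- A half-disc `{t ∈ B(c, r) | κ Im t > 0}` is preconnected (it is convex). [folklore] -/
theorem isPreconnected_halfBall_pos (c : ℂ) (r κ : ℝ) :
    IsPreconnected {t ∈ ball c r | 0 < κ * t.im} := by
  have hlin : IsLinearMap ℝ fun t : ℂ => κ * t.im :=
    { map_add := fun x y => by simp [mul_add]
      map_smul := fun a x => by simp; ring }
  exact ((convex_ball c r).inter (convex_halfSpace_gt hlin 0)).isPreconnected

/-- A half-disc `{t ∈ B(c, r) | κ Im t < 0}` is preconnected (it is convex). [folklore] -/
theorem isPreconnected_halfBall_neg (c : ℂ) (r κ : ℝ) :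
    IsPreconnected {t ∈ ball c r | κ * t.im < 0} := by
  have hlin : IsLinearMap ℝ fun t : ℂ => κ * t.im :=
    { map_add := fun x y => by simp [mul_add]
      map_smul := fun a x => by simp; ring }
  exact ((convex_ball c r).inter (convex_halfSpace_lt hlin 0)).isPreconnected

/-- A real point of a disc is in the closure of each of its two half-discs: `s + iu σ → s` as
`u → 0⁺`, `σ = sign κ`. [folklore] -/
theorem ofReal_mem_closure_halfBall {κ : ℝ} (hκ : κ ≠ 0) (s : ℝ) {c : ℂ} {r : ℝ}
    (hs : (s : ℂ) ∈ ball c r) : (s : ℂ) ∈ closure {t ∈ ball c r | 0 < κ * t.im} := by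
  have hlim : Tendsto (fun u : ℝ => (s : ℂ) + (u * κ : ℝ) * Complex.I) (𝓝[>] 0) (𝓝 (s : ℂ)) := by
    have h : Continuous fun u : ℝ => (s : ℂ) + (u * κ : ℝ) * Complex.I := by fun_prop
    simpa using (h.tendsto 0).mono_left nhdsWithin_le_nhds
  refine mem_closure_of_tendsto hlim ?_
  have hball : ∀ᶠ u : ℝ in 𝓝[>] 0, (s : ℂ) + (u * κ : ℝ) * Complex.I ∈ ball c r :=
    hlim.eventually (isOpen_ball.mem_nhds hs)
  filter_upwards [hball, self_mem_nhdsWithin] with u hu hu0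
  refine ⟨hu, ?_⟩
  have hu0' : (0 : ℝ) < u := hu0
  simp only [Complex.add_im, Complex.ofReal_im, Complex.mul_im, Complex.ofReal_re, Complex.I_im,
    mul_one, Complex.I_re, mul_zero, add_zero, zero_add]
  nlinarith [mul_self_pos.2 hκ]

variable {R : Type*} [CommSemiring R] [Algebra R ℂ]
variable (p : MvPolynomial (Fin 2) R)

/-- **The two half-discs of a real chart.** For a real chart `ψ` on the disc `D = B(v k, r)`
(`ψ(D) ⊆ A ∩ Ω`, `ψ(t)_k = t`, `ψ(conj t) = conj ψ(t)`, uniqueness on `A ∩ Ω`) and a non-zero real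
`κ`, the images `U₊ = ψ{κ Im t > 0}`, `U₋ = ψ{κ Im t < 0}` of the two half-discs are preconnected
subsets of the non-real locus interchanged by `conj`, they contain all non-real points of `A` in
`N = Ω ∩ {z_k ∈ D}`, and every point of `A ∩ N` lies in the closure of `U₊ ∪ U₋` (real points
are limits `ψ(s + iuσ) → ψ(s)`) (Rokhlin 1974, §2: near a real point the non-real points form two
half-neighbourhoods interchanged by `conj`).
[cite: Rokhlin1974, §2] -/
theorem realChart_halfDiscs {ψ : ℂ → Fin 2 → ℂ} {k : Fin 2} {v : Fin 2 → ℝ} {r : ℝ}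
    {Ω : Set (Fin 2 → ℂ)} (hψc : ∀ t ∈ ball ((v k : ℂ)) r, ContinuousAt ψ t)
    (hψ : ∀ t ∈ ball ((v k : ℂ)) r, ψ t ∈ Ω ∧ aeval (ψ t) p = 0 ∧ ψ t k = t ∧
      ψ (conj t) = star (ψ t))
    (huniq : ∀ z ∈ Ω, aeval z p = 0 → ψ (z k) = z) {κ : ℝ} (hκ : κ ≠ 0) :
    ψ '' {t ∈ ball ((v k : ℂ)) r | 0 < κ * t.im} ⊆ nonRealLocus p ∧
    ψ '' {t ∈ ball ((v k : ℂ)) r | κ * t.im < 0} ⊆ nonRealLocus p ∧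
    IsPreconnected (ψ '' {t ∈ ball ((v k : ℂ)) r | 0 < κ * t.im}) ∧
    IsPreconnected (ψ '' {t ∈ ball ((v k : ℂ)) r | κ * t.im < 0}) ∧
    star '' (ψ '' {t ∈ ball ((v k : ℂ)) r | 0 < κ * t.im}) = ψ '' {t ∈ ball ((v k : ℂ)) r | κ * t.im < 0} ∧
    star '' (ψ '' {t ∈ ball ((v k : ℂ)) r | κ * t.im < 0}) = ψ '' {t ∈ ball ((v k : ℂ)) r | 0 < κ * t.im} ∧
    nonRealLocus p ∩ (Ω ∩ {z | z k ∈ ball ((v k : ℂ)) r}) ⊆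
      ψ '' {t ∈ ball ((v k : ℂ)) r | 0 < κ * t.im} ∪ ψ '' {t ∈ ball ((v k : ℂ)) r | κ * t.im < 0} ∧
    complexZeroLocus p ∩ (Ω ∩ {z | z k ∈ ball ((v k : ℂ)) r}) ⊆
      closure (ψ '' {t ∈ ball ((v k : ℂ)) r | 0 < κ * t.im} ∪
        ψ '' {t ∈ ball ((v k : ℂ)) r | κ * t.im < 0}) := by
  set D := ball ((v k : ℂ)) r with hD
  set Sp := {t ∈ D | 0 < κ * t.im} with hSp
  set Sn := {t ∈ D | κ * t.im < 0} with hSn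
  -- conjugation on the parameter disc
  have hconjD : ∀ t ∈ D, conj t ∈ D := fun t ht => by
    rw [hD, mem_ball] at ht ⊢
    rwa [← Complex.conj_ofReal, Complex.dist_conj_conj]
  have hconjp : ∀ t ∈ Sp, conj t ∈ Sn := fun t ht =>
    ⟨hconjD t ht.1, by rw [Complex.conj_im, mul_neg]; exact neg_lt_zero.2 ht.2⟩
  have hconjn : ∀ t ∈ Sn, conj t ∈ Sp := fun t ht =>
    ⟨hconjD t ht.1, by rw [Complex.conj_im, mul_neg]; exact neg_pos.2 ht.2⟩
  -- non-real
  have hnr : ∀ t ∈ D, κ * t.im ≠ 0 → ψ t ∈ nonRealLocus p := fun t ht h0 =>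
    ⟨(hψ t ht).2.1, k, by rw [(hψ t ht).2.2.1]; exact fun h => h0 (by rw [h, mul_zero])⟩
  have hsubp : ψ '' Sp ⊆ nonRealLocus p := by
    rintro _ ⟨t, ht, rfl⟩; exact hnr t ht.1 ht.2.ne'
  have hsubn : ψ '' Sn ⊆ nonRealLocus p := by
    rintro _ ⟨t, ht, rfl⟩; exact hnr t ht.1 ht.2.ne
  -- images of conj-related half-discs
  have hstar : ∀ {S T : Set ℂ}, S ⊆ D → (∀ t ∈ S, conj t ∈ T) → (∀ t ∈ T, conj t ∈ S) →
      star '' (ψ '' S) = ψ '' T := by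
    intro S T hSD hST hTS
    apply Subset.antisymm
    · rintro _ ⟨_, ⟨t, ht, rfl⟩, rfl⟩
      exact ⟨conj t, hST t ht, (hψ t (hSD ht)).2.2.2⟩
    · rintro _ ⟨t, ht, rfl⟩
      refine ⟨ψ (conj t), ⟨conj t, hTS t ht, rfl⟩, ?_⟩
      have h := (hψ (conj t) (hSD (hTS t ht))).2.2.2
      rw [Complex.conj_conj] at h
      rw [h]
  have hcont : ContinuousOn ψ D := fun t ht => (hψc t ht).continuousWithinAt
  refine ⟨hsubp, hsubn, (isPreconnected_halfBall_pos _ r κ).image _ (hcont.mono fun t ht => ht.1),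
    (isPreconnected_halfBall_neg _ r κ).image _ (hcont.mono fun t ht => ht.1),
    hstar (fun t ht => ht.1) hconjp hconjn, hstar (fun t ht => ht.1) hconjn hconjp, ?_, ?_⟩
  · -- non-real points of `A ∩ N` come from non-real parameters
    rintro z ⟨hzNR, hzΩ, hzk⟩
    have hz : ψ (z k) = z := huniq z hzΩ hzNR.1
    have him : (z k).im ≠ 0 := by
      intro h0
      -- `z k` real: then `z = ψ (z k)` is real
      have hreal : conj (z k) = z k := Complex.conj_eq_iff_im.2 h0
      have hst : star z = z := by
        have h := (hψ (z k) hzk).2.2.2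
        rw [hreal, hz] at h
        exact h.symm
      obtain ⟨-, i, hi⟩ := hzNR
      apply hi
      have := congr_fun hst i
      rw [star_apply] at this
      exact Complex.conj_eq_iff_im.1 this
    rcases lt_or_gt_of_ne (mul_ne_zero hκ him) with h | h
    · exact Or.inr ⟨z k, ⟨hzk, h⟩, hz⟩
    · exact Or.inl ⟨z k, ⟨hzk, h⟩, hz⟩
  · -- every point of `A ∩ N` is in `U₊ ∪ U₋` or a limit of points of `U₊`
    rintro z ⟨hzA, hzΩ, hzk⟩
    have hz : ψ (z k) = z := huniq z hzΩ hzA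
    by_cases him : (z k).im = 0
    · -- real parameter: approach from the half-disc `Sp`
      have hzk' : ((z k).re : ℂ) = z k := Complex.ext rfl (by simp [him])
      have hcl : z k ∈ closure Sp := by
        have h := ofReal_mem_closure_halfBall hκ (z k).re (c := (v k : ℂ)) (r := r)
          (by rw [hzk']; exact hzk)
        rwa [hzk'] at h
      rw [← hz]
      exact closure_mono (image_mono fun t ht => ht) ((hψc _ hzk).continuousWithinAt.mem_closure_image
        hcl) |> fun h => closure_mono subset_union_left h
    · refine subset_closure ?_
      rcases lt_or_gt_of_ne (mul_ne_zero hκ him) with h | h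
      · exact Or.inr ⟨z k, ⟨hzk, h⟩, hz⟩
      · exact Or.inl ⟨z k, ⟨hzk, h⟩, hz⟩

end HalfDiscs

end Literature.AlgebraicGeometry.RealAlgebraic
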